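import Summits.NavierStokesRegularity.NavierStokesRegularity.Theorems.PalasekTowerBreakdownEpisodeInductionNoSwirlForced
import Summits.NavierStokesRegularity.NavierStokesRegularity.Theorems.PalasekTowerBreakdownSterileTowerFinite
import Summits.NavierStokesRegularity.FluidComputer.ClayBlowupRows
import Literature.Analysis.FluidPDE.ForcedSymmetryPreservationShift
import Literature.Analysis.FluidPDE.TaoH1APrioriForcedToolkit

/-!
# NavierStokesRegularity — route `PalasekTowerBreakdown`: the SLICE form of the no-swirl lever,
# FACT-FREE — a tower realisation has NO axisymmetric swirl-free slice before a swirl-free force era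

Supports `stmt-NavierStokesRegularity-19178` (`PalasekTowerBreakdown.EpisodeInduction := EpisodeInductionG`)
as a helper. Cell `ns-blowup`, seat `ns-blowup-lean` (g9). LABEL: E–C typing + kernel analysis
(theorems only; no definition; NO named fact). WHAT THIS IS NOT: not Navier–Stokes evidence and NOT a
refutation of any item — no stage is constructed; the one remaining hypothesis of each template is an
OPEN construction (a registered stage with an axisymmetric swirl-free readout slice).

disprove-1's `not_signedNoSwirlSlice_of_heredity` (p451698) forbids, under the heredity items, a
SINGLE-SIGNED swirl-free integrable readout slice on a registered stage, MODULO the two printed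
Gallay–Šverák 2015 facts (speed cap). The forced Ladyzhenskaya / Ukhovskii–Yudovich a-priori bound
(`axisymmetricNoSwirl_enstrophy_apriori_forced`, lean g9 p452050) replaces the cap by an `H¹` bound and
needs NO sign, NO integrability of `ω_θ/r`, NO fact:

* `Realisation.not_noSwirl_slice` — a tower realisation `W` (any rates, `ν > 0`) has NO time
  `t₀ ∈ [0, T)` at which `W.u t₀` is axisymmetric swirl-free while the force slices `W.f t`, `t ≥ t₀`,
  are axisymmetric swirl-free (e.g. vanish): symmetry propagates on `[t₀, T']` (lean g8's shifted-slab
  preservation), the forced a-priori bound applied to the flow translated by `t₀` bounds the enstrophy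
  on `[t₀, T)` uniformly, the smooth class bounds it on `[0, t₀]`, and a uniform enstrophy bound on
  `[0, T)` gives a finite-energy classical continuation past `T`
  (`ForcedContinuation.exists_forced_extension_of_enstrophy_bounded_Ico`, F2 discharged) — continuous on
  the box `[0, T] × B̄(0, radius)`, which the floors forbid (`Realisation.false_of_continuousOn_box`);
* `palasekTowerBreakdown_not_episodeInduction_of_noSwirl_slice` — under the PARENT crux, a pinned
  (`Λ = 8`, `θ = 6/5`) rigid QUIET wide design carrying a registered stage `s` at a level `k ≥ 1` whose
  readout slice `s.u (τ k)` is axisymmetric swirl-free is absurd (QUIET: `S.f ≡ 0` on `[τ₁, ∞) ⊇ [τ_k, ∞)`,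
  so no hypothesis on the force at all); `…_episodeInduction_no_noSwirl_slice` (slice-negation form);
  `PalasekTowerBreakdownNegative.palasekTowerBreakdown_not_heredity_pair_of_noSwirl_slice` (the pair
  19249 ∧ 19250 through the route's glue).

What the GS facts still buy that this does not: item 19249 ALONE (one hand-over needs the quantitative
cap `< c₁Y₂`); the child 19250 alone from a level-`≥ 2` slice needs a realisation constructor with
identified fields (`Schedule.nonempty_realisation_of_nonempty_stages` only returns `Nonempty`) — not
done here.

References: O. A. Ladyzhenskaya, Zap. Naučn. Sem. LOMI 7 (1968); M. R. Ukhovskii, V. I. Yudovich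
(1968) — through P. G. Lemarié-Rieusset (2016), Thm. 10.4 [cite: LemarieRieusset2016, Thm 10.4 (p. 285)];
T. Tao, Anal. PDE 6 (2013), Thm. 5.4, Cor. 11.4 [cite: Tao2011, Cor. 11.4]; S. Palasek, arXiv:2605.13827 §4
[cite: Palasek2026ElementaryModel, §4].
-/

-- `Summit.<Summit>.<Problem>` is the tree's mandated summit-side namespace (CONVENTIONS §2); for this
-- single-conjunct summit the two coincide, so the duplicate is deliberate.
set_option linter.dupNamespace false

noncomputable section

namespace Summit.NavierStokesRegularity.FluidComputer.PalasekTowerClayBridge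

open Set MeasureTheory Filter Topology Function
open scoped ENNReal ContDiff NNReal
open Literature.Analysis.FluidPDE
open Summit.NavierStokesRegularity.FluidComputer

namespace Realisation

variable {ν : ℝ} {R : TowerRates} (W : Realisation ν R)

/-- An `H^∞`-type slice bound gives `u(t₀), ∇u(t₀) ∈ L²` (continuity + finite `∫⁻ ‖D⁰‖²`, `∫⁻ ‖D¹‖²`).
[folklore] -/
private theorem memLp_slice_of_bounds {v : EuclideanSpace ℝ (Fin 3) → EuclideanSpace ℝ (Fin 3)}
    (hv : ContDiff ℝ 1 v) (h0 : ∫⁻ x, ‖iteratedFDeriv ℝ 0 v x‖ₑ ^ 2 < ⊤)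
    (h1 : ∫⁻ x, ‖iteratedFDeriv ℝ 1 v x‖ₑ ^ 2 < ⊤) :
    MemLp v 2 volume ∧ MemLp (fderiv ℝ v) 2 volume := by
  have hvc : Continuous v := hv.continuous
  have hDc : Continuous (fderiv ℝ v) := hv.continuous_fderiv one_ne_zero
  have e0 : ∫⁻ x, ‖v x‖ₑ ^ 2 = ∫⁻ x, ‖iteratedFDeriv ℝ 0 v x‖ₑ ^ 2 :=
    lintegral_congr fun x => by rw [← ofReal_norm, ← ofReal_norm, norm_iteratedFDeriv_zero]
  have e1 : ∫⁻ x, ‖fderiv ℝ v x‖ₑ ^ 2 = ∫⁻ x, ‖iteratedFDeriv ℝ 1 v x‖ₑ ^ 2 :=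
    lintegral_congr fun x => by
      rw [← ofReal_norm, ← ofReal_norm, ← norm_iteratedFDeriv_fderiv, norm_iteratedFDeriv_zero]
  refine ⟨(memLp_two_iff_integrable_sq_norm hvc.aestronglyMeasurable).2
      (integrable_sq_norm_of_lintegral_lt_top hvc (by rw [e0]; exact h0)),
    (memLp_two_iff_integrable_sq_norm hDc.aestronglyMeasurable).2
      (integrable_sq_norm_of_lintegral_lt_top hDc (by rw [e1]; exact h1))⟩

/-- **A TOWER REALISATION HAS NO AXISYMMETRIC SWIRL-FREE SLICE BEFORE A SWIRL-FREE FORCE ERA** (any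
rates `R`, any `ν > 0`; no named fact; forced Ladyzhenskaya / Ukhovskii–Yudovich). If at some
`t₀ ∈ [0, T)` the slice `W.u t₀` is axisymmetric without swirl and the force slices `W.f t` are
axisymmetric without swirl for all `t ≥ t₀` (e.g. vanish: the quiet era), then `False`: symmetry
propagates to `[t₀, T)` (`isAxisymmetric_of_clayForce_Icc` / `hasNoSwirl_of_clayForce_Icc`); the forced
a-priori enstrophy bound (`axisymmetricNoSwirl_enstrophy_apriori_forced`, applied to the flow
translated by `t₀`, data `W.u t₀ ∈ H^∞`, force `W.f (· + t₀)`) bounds `∫ |∇u(t)|²` on `[t₀, T)`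
uniformly, Tao's class bounds it on `[0, t₀]`; the uniform bound on `[0, T)` yields a finite-energy
classical extension past `T` (`ForcedContinuation.exists_forced_extension_of_enstrophy_bounded_Ico`),
continuous on the box `[0, T] × B̄(0, radius)`, contradicting the floors
(`false_of_continuousOn_box`). [cite: LemarieRieusset2016, Thm 10.4 (p. 285); Tao2011, Cor. 11.4] -/
theorem not_noSwirl_slice (hν : 0 < ν) {t₀ : ℝ} (ht₀ : t₀ ∈ Ico 0 W.T)
    (hfA : ∀ t : ℝ, t₀ ≤ t → IsAxisymmetric (W.f t)) (hfS : ∀ t : ℝ, t₀ ≤ t → HasNoSwirl (W.f t))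
    (hA : IsAxisymmetric (W.u t₀)) (hS : HasNoSwirl (W.u t₀)) : False := by
  have hT : 0 < W.T := W.T_pos
  have ht₀0 : 0 ≤ t₀ := ht₀.1
  have ht₀T : t₀ < W.T := ht₀.2
  -- ONE energy bound on `[0, T)` (Tao's Lemma 8.1 with force)
  obtain ⟨E, hEt, hE, -⟩ := energy_dissipation_le_of_clayForce hν hT W.classical W.force_smooth
    W.force_decay W.energy
  -- Tao's spatial class on every closed sub-slab
  have hTao : ∀ τ₁ ∈ Ioo 0 W.T, HasBoundedSobolevNormsOn (Icc 0 τ₁) W.u := fun τ₁ hτ₁ =>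
    (W.classical_Icc hτ₁.1 hτ₁.2).hasBoundedSobolevNormsOn_of_clayForce hν hτ₁.1
      ⟨E.toNNReal, fun t ht => (hE t ⟨ht.1, ht.2.trans_lt hτ₁.2⟩).trans (ENNReal.coe_toNNReal hEt.ne).ge⟩
      W.datum_decay W.force_smooth W.force_decay
  -- the force has bounded Sobolev norms on `[0, T]`
  have hfD : HasUniformRapidDecayOn (Icc 0 W.T) W.f :=
    W.force_decay.hasUniformRapidDecayOn_Icc W.force_smooth hT
  obtain ⟨hfB, -⟩ := hfD.hasBoundedSobolevNormsOn_Icc (W.force_smooth.isSmoothSpaceTimeOn_Icc W.T) hT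
  obtain ⟨P₁, hP₁⟩ := hfB 1
  obtain ⟨P₂, hP₂⟩ := hfB 2
  -- the slice `t₀`: `H^∞` bounds read on the closed sub-slab `[0, t₁]`, `t₁ = (t₀ + T)/2`
  set t₁ : ℝ := (t₀ + W.T) / 2 with ht₁def
  have ht₁0 : 0 < t₁ := by rw [ht₁def]; linarith
  have ht₁T : t₁ < W.T := by rw [ht₁def]; linarith
  have ht₀t₁ : t₀ < t₁ := by rw [ht₁def]; linarith
  have ht₀m : t₀ ∈ Icc 0 t₁ := ⟨ht₀0, ht₀t₁.le⟩
  obtain ⟨C₀, hC₀⟩ := hTao t₁ ⟨ht₁0, ht₁T⟩ 0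
  obtain ⟨C₁, hC₁⟩ := hTao t₁ ⟨ht₁0, ht₁T⟩ 1
  obtain ⟨C₂, hC₂⟩ := hTao t₁ ⟨ht₁0, ht₁T⟩ 2
  have hu1 : ContDiff ℝ 1 (W.u t₀) :=
    ((W.classical_Icc ht₁0 ht₁T).contDiff_velocity ht₀m).of_le (by norm_cast)
  obtain ⟨h₀, h₁⟩ := memLp_slice_of_bounds hu1 ((hC₀ t₀ ht₀m).trans_lt ENNReal.coe_lt_top)
    ((hC₁ t₀ ht₀m).trans_lt ENNReal.coe_lt_top)
  -- the a-priori constant for the translated problem on slabs of length `≤ T − t₀`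
  have hTt : 0 < W.T - t₀ := by linarith
  obtain ⟨K, hK0, hK⟩ := axisymmetricNoSwirl_enstrophy_apriori_forced hν hTt
    (ENNReal.toReal_nonneg (a := E)) (C₁.coe_nonneg) (C₂.coe_nonneg) (P₁.coe_nonneg) (P₂.coe_nonneg)
  -- ONE enstrophy bound on `[0, T)`
  have hbound : ∀ t ∈ Ico 0 W.T,
      ∫⁻ x, ENNReal.ofReal (frobeniusNormSq (fderiv ℝ (W.u t) x)) ≤ ENNReal.ofReal (3 * (C₁ + K)) := by
    intro t ht
    -- `∫ |∇u(t)|²_F ≤ 3 ∫ ‖Du(t)‖²`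
    have n1 : ∀ x, ‖fderiv ℝ (W.u t) x‖ = ‖iteratedFDeriv ℝ 1 (W.u t) x‖ := fun x => by
      rw [← norm_iteratedFDeriv_fderiv, norm_iteratedFDeriv_zero]
    have hfrob : ∫⁻ x, ENNReal.ofReal (frobeniusNormSq (fderiv ℝ (W.u t) x)) ≤
        3 * ∫⁻ x, ‖iteratedFDeriv ℝ 1 (W.u t) x‖ₑ ^ 2 := by
      calc ∫⁻ x, ENNReal.ofReal (frobeniusNormSq (fderiv ℝ (W.u t) x))
          ≤ ∫⁻ x, 3 * ‖fderiv ℝ (W.u t) x‖ₑ ^ 2 :=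
            lintegral_mono fun x => ofReal_frobeniusNormSq_le_three_mul_enorm_sq _
        _ = 3 * ∫⁻ x, ‖iteratedFDeriv ℝ 1 (W.u t) x‖ₑ ^ 2 := by
            rw [lintegral_const_mul' _ _ (by norm_num)]
            congr 1
            refine lintegral_congr fun x => ?_
            rw [← ofReal_norm, ← ofReal_norm, n1 x]
    have h3 : ENNReal.ofReal (3 * ((C₁ : ℝ) + K)) = 3 * (ENNReal.ofReal (C₁ : ℝ) + ENNReal.ofReal K) := by
      rw [ENNReal.ofReal_mul (by norm_num : (0:ℝ) ≤ 3), ENNReal.ofReal_ofNat,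
        ENNReal.ofReal_add C₁.coe_nonneg hK0]
    rw [h3]
    refine hfrob.trans (mul_le_mul_right ?_ 3)
    rcases le_or_gt t t₀ with htt | htt
    · -- `t ≤ t₀ < t₁`: Tao's class on `[0, t₁]`
      have h := hC₁ t ⟨ht.1, htt.trans ht₀t₁.le⟩
      rw [← ENNReal.ofReal_coe_nnreal] at h
      exact h.trans le_self_add
    · -- `t₀ < t < T`: the translated flow on `[0, T' − t₀]`, `T' = (t + T)/2`
      set T' : ℝ := (t + W.T) / 2 with hT'def
      have hT'0 : 0 < T' := by rw [hT'def]; linarith [ht.1]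
      have hT'T : T' < W.T := by rw [hT'def]; linarith [ht.2]
      have htT' : t ≤ T' := by rw [hT'def]; linarith [ht.2]
      have ht₀T' : t₀ < T' := htt.trans_le htT'
      have hcl := W.classical_Icc hT'0 hT'T
      -- symmetry on `[t₀, T']`
      have hclt : IsClassicalNSSolutionOn (Icc t₀ T') ν W.f W.u W.p :=
        hcl.mono (Icc_subset_Icc_left ht₀0) (uniqueDiffOn_Icc ht₀T')
      have huE : ∃ C : ℝ≥0∞, C < ⊤ ∧ ∀ r ∈ Icc t₀ T', ∫⁻ x, ‖W.u r x‖ₑ ^ 2 ≤ C :=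
        ⟨E, hEt, fun r hr => hE r ⟨ht₀0.trans hr.1, hr.2.trans_lt hT'T⟩⟩
      have hfA' : ∀ r ∈ Icc t₀ T', IsAxisymmetric (W.f r) := fun r hr => hfA r hr.1
      have hfS' : ∀ r ∈ Icc t₀ T', HasNoSwirl (W.f r) := fun r hr => hfS r hr.1
      have hax : ∀ r ∈ Icc t₀ T', IsAxisymmetric (W.u r) :=
        hclt.isAxisymmetric_of_clayForce_Icc hν ht₀0 ht₀T' W.force_smooth W.force_decay h₀ h₁ huE
          hfA' hA
      have hsw : ∀ r ∈ Icc t₀ T', HasNoSwirl (W.u r) :=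
        hclt.hasNoSwirl_of_clayForce_Icc hν ht₀0 ht₀T' W.force_smooth W.force_decay h₀ h₁ huE
          hfA' hfS' hA hS
      -- the translated classical solution on `[0, T' − t₀]`
      have hsol := hcl.translate_Icc_zero_anyForce ht₀0 ht₀T'
      have hle : T' - t₀ ≤ W.T - t₀ := by linarith
      have hpos : 0 < T' - t₀ := by linarith
      have hmem : ∀ s ∈ Icc 0 (T' - t₀), s + t₀ ∈ Icc t₀ T' := fun s hs =>
        ⟨by linarith [hs.1], by linarith [hs.2]⟩
      have hmem0 : ∀ s ∈ Icc 0 (T' - t₀), s + t₀ ∈ Icc 0 T' := fun s hs =>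
        ⟨by linarith [hs.1], by linarith [hs.2]⟩
      have hmemT : ∀ s ∈ Icc 0 (T' - t₀), s + t₀ ∈ Icc 0 W.T := fun s hs =>
        ⟨by linarith [hs.1], by linarith [hs.2]⟩
      have hH' : HasBoundedSobolevNormsOn (Icc 0 (T' - t₀)) (fun s => W.u (s + t₀)) := fun n => by
        obtain ⟨C, hC⟩ := hTao T' ⟨hT'0, hT'T⟩ n
        exact ⟨C, fun s hs => hC (s + t₀) (hmem0 s hs)⟩
      have hDt := hK hpos hle hsol hH'
        (fun s hs => hax (s + t₀) (hmem s hs)) (fun s hs => hsw (s + t₀) (hmem s hs))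
        (fun s hs => hfA (s + t₀) (hmem s hs).1) (fun s hs => hfS (s + t₀) (hmem s hs).1)
        (fun s hs => by
          rw [ENNReal.ofReal_toReal hEt.ne]
          exact hE (s + t₀) ⟨(hmem0 s hs).1, (hmem0 s hs).2.trans_lt hT'T⟩)
        (by rw [zero_add, ENNReal.ofReal_coe_nnreal]; exact hC₁ t₀ ht₀m)
        (by rw [zero_add, ENNReal.ofReal_coe_nnreal]; exact hC₂ t₀ ht₀m)
        (fun s hs => by rw [ENNReal.ofReal_coe_nnreal]; exact hP₁ (s + t₀) (hmemT s hs))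
        (fun s hs => by rw [ENNReal.ofReal_coe_nnreal]; exact hP₂ (s + t₀) (hmemT s hs))
        (t - t₀) ⟨by linarith, by linarith⟩
      rw [sub_add_cancel] at hDt
      exact hDt.trans le_add_self
  -- the finite-energy classical extension past `T`, and the floors
  obtain ⟨T', hT', U, P, hU, hUu, -⟩ :=
    ForcedContinuation.exists_forced_extension_of_enstrophy_bounded_Ico
      tao2011_smooth_local_existence_forced_holds hν hT W.force_smooth W.force_decay W.classical
      ⟨E, hEt, hE⟩ ⟨ENNReal.ofReal (3 * (C₁ + K)), ENNReal.ofReal_lt_top, hbound⟩ hTao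
  refine W.false_of_continuousOn_box (v := U) ?_ hUu
  exact hU.smooth_velocity.continuousOn.mono
    (prod_mono (Icc_subset_Icc_right hT'.le) (subset_univ _))

/-- The case of a force that VANISHES from `t₀` on (the register's quiet era): a realisation has no
axisymmetric swirl-free slice at or after the last time its force was active.
[cite: LemarieRieusset2016, Thm 10.4 (p. 285)] -/
theorem not_noSwirl_slice_of_force_zero (hν : 0 < ν) {t₀ : ℝ} (ht₀ : t₀ ∈ Ico 0 W.T)
    (hf : ∀ t : ℝ, t₀ ≤ t → W.f t = 0) (hA : IsAxisymmetric (W.u t₀)) (hS : HasNoSwirl (W.u t₀)) :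
    False := by
  have hzA : IsAxisymmetric (0 : EuclideanSpace ℝ (Fin 3) → EuclideanSpace ℝ (Fin 3)) := by
    intro θ x
    ext i
    fin_cases i <;> simp
  have hzS : HasNoSwirl (0 : EuclideanSpace ℝ (Fin 3) → EuclideanSpace ℝ (Fin 3)) := by
    intro x
    simp [swirl]
  exact W.not_noSwirl_slice hν ht₀ (fun t ht => by rw [hf t ht]; exact hzA)
    (fun t ht => by rw [hf t ht]; exact hzS) hA hS

end Realisation

end Summit.NavierStokesRegularity.FluidComputer.PalasekTowerClayBridge

/-! ## The route's register: the parent crux and the heredity pair -/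

namespace Summit.NavierStokesRegularity.NavierStokesRegularity.Theorems

open Set MeasureTheory Filter Topology Function
open scoped ENNReal ContDiff NNReal
open Summit.NavierStokesRegularity.NavierStokesRegularity.Theses
open Summit.NavierStokesRegularity.FluidComputer
open Summit.NavierStokesRegularity.FluidComputer.PalasekTowerClayBridge
open Literature.Analysis.FluidPDE

section Register

variable {S : Schedule TowerRates.wide}

/-- **THE SLICE-FORM NO-SWIRL LEVER AGAINST THE PARENT, FACT-FREE**: under `EpisodeInduction` (K2G),
a pinned (`Λ = 8`, `θ = 6/5`) rigid QUIET schedule on the wide-base rates carrying a registered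
(`Margins.routeG`, unit viscosity) stage `s` at a level `k ≥ 1` whose readout slice `s.u (τ k)` is
axisymmetric without swirl is absurd. No cap, no sign condition on `ω_θ`, no integrability of `ω_θ/r`,
no named fact, no hypothesis on the force (QUIET: `S.f ≡ 0` on `[τ₁, ∞) ⊇ [τ_k, ∞)`). Proof: K2G gives a
stage at every level of the SAME design (`palasekTowerBreakdown_episodeInduction_nonempty_stage_all`),
glued into the realisation `Realisation.ofEpisodes`; the stage `s` IS that realisation's flow on
`[0, τ_k]` (forced uniqueness, `palasekTowerBreakdown_stage_velocity_eq_solution_rates`), so the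
realisation has an axisymmetric swirl-free slice at `τ_k` with a vanishing force afterwards —
`Realisation.not_noSwirl_slice_of_force_zero`. [cite: LemarieRieusset2016, Thm 10.4 (p. 285); Palasek2026ElementaryModel, §4] -/
theorem palasekTowerBreakdown_episodeInduction_no_noSwirl_slice
    (h : PalasekTowerBreakdown.EpisodeInduction) (hP : S.Pins 8 (6 / 5)) (hR : S.Rigid) (hQ : S.Quiet)
    {k : ℕ} (hk : 1 ≤ k) (s : Stage 1 TowerRates.wide S (Margins.routeG TowerRates.wide) k) :
    ¬ (IsAxisymmetric (s.u (S.τ k)) ∧ HasNoSwirl (s.u (S.τ k))) := by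
  rintro ⟨hA, hS⟩
  -- a level-1 stage and the K2G step on this design; the glued realisation
  obtain ⟨s₁⟩ := palasekTowerBreakdown_episodeInduction_nonempty_stage_all h hP hR hQ hk s 1
  have step : ∀ n, ∀ s' : Stage 1 TowerRates.wide S (Margins.routeG TowerRates.wide) (n + 1),
      ∃ s'' : Stage 1 TowerRates.wide S (Margins.routeG TowerRates.wide) (n + 1 + 1), s'.Extends s'' :=
    fun n s' => h S hP hR hQ (n + 1) (by omega) s'
  set W := Realisation.ofEpisodes S s₁ step with hWdef
  have hWf : W.f = S.f := Realisation.ofEpisodes_f S s₁ step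
  have hWT : W.T = S.T := Realisation.ofEpisodes_T S s₁ step
  have hW0 : W.u 0 = S.u₀ := Realisation.ofEpisodes_u_zero S s₁ step
  -- the stage is the realisation's flow on `[0, τ_k]`
  have hτT : S.τ k < W.T := by rw [hWT]; exact S.τ_lt_T k
  set T' : ℝ := (S.τ k + W.T) / 2 with hT'def
  have hT'0 : 0 < T' := by rw [hT'def]; linarith [S.τ_pos k]
  have hT'T : T' < W.T := by rw [hT'def]; linarith
  have hτT' : S.τ k ≤ T' := by rw [hT'def]; linarith
  have hU : IsClassicalNSSolutionOn (Icc 0 T') 1 S.f W.u W.p := by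
    rw [← hWf]
    exact W.classical_Icc hT'0 hT'T
  have heq : s.u (S.τ k) = W.u (S.τ k) :=
    palasekTowerBreakdown_stage_velocity_eq_solution_rates one_pos s hτT' hU hW0 (W.energy T' hT'T)
      (S.τ k) ⟨(S.τ_pos k).le, le_rfl⟩
  -- quiet era: the force vanishes on `[τ_k, ∞)`
  have hf : ∀ t : ℝ, S.τ k ≤ t → W.f t = 0 := fun t ht => by
    rw [hWf]
    exact hQ t ((S.τ_mono hk).trans ht)
  refine W.not_noSwirl_slice_of_force_zero one_pos ⟨(S.τ_pos k).le, hτT⟩ hf ?_ ?_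
  · rw [← heq]; exact hA
  · rw [← heq]; exact hS

/-- **Packaged**: ONE registered stage, at any level `k ≥ 1`, of a pinned rigid quiet wide design, with
an axisymmetric swirl-free readout slice, refutes the parent crux `EpisodeInduction` — kernel, no fact,
no cap, no sign. The stage is NOT constructed here. [cite: LemarieRieusset2016, Thm 10.4 (p. 285); Palasek2026ElementaryModel, §4] -/
theorem palasekTowerBreakdown_not_episodeInduction_of_noSwirl_slice (hP : S.Pins 8 (6 / 5))
    (hR : S.Rigid) (hQ : S.Quiet) {k : ℕ} (hk : 1 ≤ k)
    (s : Stage 1 TowerRates.wide S (Margins.routeG TowerRates.wide) k)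
    (hA : IsAxisymmetric (s.u (S.τ k))) (hS : HasNoSwirl (s.u (S.τ k))) :
    ¬ PalasekTowerBreakdown.EpisodeInduction := fun h =>
  palasekTowerBreakdown_episodeInduction_no_noSwirl_slice h hP hR hQ hk s ⟨hA, hS⟩

/-- `∃`-form of the template. [cite: Palasek2026ElementaryModel, §4] -/
theorem palasekTowerBreakdown_not_episodeInduction_of_exists_noSwirl_slice
    (hW : ∃ (S : Schedule TowerRates.wide) (k : ℕ)
      (s : Stage 1 TowerRates.wide S (Margins.routeG TowerRates.wide) k),
      S.Pins 8 (6 / 5) ∧ S.Rigid ∧ S.Quiet ∧ 1 ≤ k ∧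
        IsAxisymmetric (s.u (S.τ k)) ∧ HasNoSwirl (s.u (S.τ k))) :
    ¬ PalasekTowerBreakdown.EpisodeInduction := by
  obtain ⟨S, k, s, hP, hR, hQ, hk, hA, hS⟩ := hW
  exact palasekTowerBreakdown_not_episodeInduction_of_noSwirl_slice hP hR hQ hk s hA hS

end Register

end Summit.NavierStokesRegularity.NavierStokesRegularity.Theorems

namespace Summit.NavierStokesRegularity.PalasekTowerBreakdownNegative

open Set
open Summit.NavierStokesRegularity.NavierStokesRegularity.Theses
open Summit.NavierStokesRegularity.NavierStokesRegularity.Theorems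
open Summit.NavierStokesRegularity.FluidComputer.PalasekTowerClayBridge
open Literature.Analysis.FluidPDE

/-- **… hence such a stage breaks the heredity PAIR of `closes`** (items 19249 ∧ 19250, through the
route's glue `EpisodeInductionGlueBy_holds`; which conjunct fails is not decided — for 19249 alone the
quantitative Gallay–Šverák cap is still needed). [cite: Palasek2026ElementaryModel, §4] -/
theorem palasekTowerBreakdown_not_heredity_pair_of_noSwirl_slice {S : Schedule TowerRates.wide}
    (hP : S.Pins 8 (6 / 5)) (hR : S.Rigid) (hQ : S.Quiet) {k : ℕ} (hk : 1 ≤ k)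
    (s : Stage 1 TowerRates.wide S (Margins.routeG TowerRates.wide) k)
    (hA : IsAxisymmetric (s.u (S.τ k))) (hS : HasNoSwirl (s.u (S.τ k))) :
    ¬ (PalasekTowerBreakdown.HeredityAtOne ∧ PalasekTowerBreakdown.HeredityFromTwo) := by
  rintro ⟨h₁, h₂⟩
  exact palasekTowerBreakdown_not_episodeInduction_of_noSwirl_slice hP hR hQ hk s hA hS
    (PalasekTowerBreakdown.EpisodeInductionGlueBy_holds h₁ h₂)

end Summit.NavierStokesRegularity.PalasekTowerBreakdownNegative

end
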